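import Literature.MathematicalPhysics.KineticTheory.EvenCollisionTubeFunctional
import Literature.MathematicalPhysics.KineticTheory.HardSphereEuler
import HarnessLib

/-!
# The correctly typed upper-half producers for the crux `EnergyCurrentTails` (stmt-9235) — seat c4, line
# `level-census-comparison`: what `ContactIntensityDomination` (stmt-9218, refuted at rung ½) should say

`JeansLoadedDice.ContactIntensityDomination` (= `AprioriTailsRattlers.…` = `SpeedCapSurgery.…`, textually) is FALSE as typed
(`Theorems/JeansLoadedDiceContactIntensityDominationRefutation.lean`, this seat; `LEAD-seat-c4-rung-half.md`): its right-hand side is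
the collision functional of TWO INDEPENDENT COPIES of the law — spatially averaged one-particle marginals — and with a constant uniform
over all marks `φ` this loses the hot-spot Laplace factor of marks living at high speed.  The two repairs below PASS rung ½ by
construction and are what the line's stubs actually consume; they are SUGGESTIONS FOR THE PLANNERS (this seat files no statement item):

* `ContactIntensityDominationLocal` (α) — the same one-sided, mark-uniform Stosszahlansatz ceiling with the ONE-COPY pair functional on
  the right, partners weighted by the normalised cone mollifier `coneKernel r` (`∫ b_r = 1`, `EvenCollisionTubeFunctional`) at a
  mesoscopic scale `r` (`∃ r₀ ∀ r < r₀ ∃ N₀`): one-sided molecular chaos `f₂(x,v,x⁺,w) ≤ C f₁(x,v) f₁(x,w)` in `L¹` against the kernel.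
  This is the natural producer of F2 `MergeCeiling` (pair events of two energetic particles) and, with a local density/energy cap, of F1.
* `ContactIntensityDominationOneRare` (γ) — the two-copy form RESTRICTED to one-rare-participant marks `φ(v,w) = ψ(v)(1+‖w‖)^k`,
  `k ≤ 3`, uniform in the continuous `ψ`: the partner enters only through bulk moments, whose local/global ratio is bounded by
  `(θmax/θmin)^{k/2} sup ρ / inf ρ` pre-shock.  This is the producer of F1 `RateCeiling` (`ψ` = shell / tail cut-off, `k ∈ {0,1}`),
  of S2a `stub_energyFluxCeiling` (`ψ(v) = ‖v‖²`, `k = 2`) and of `MeanCollisionalImpulseBound`.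
Both are open-problem class off equilibrium (as 9218 was meant to be); (α) ⟹ (γ) needs a mesoscopic moment cap; neither implies F3.
-/

noncomputable section

open MeasureTheory Set Filter
open scoped ENNReal InnerProductSpace BigOperators Classical

namespace Summit.AtomisticToContinuum.HydrodynamicLimit.Cruxes.EnergyCurrentTails.LocalCeiling

open Literature.MathematicalPhysics.KineticTheory Literature.Analysis.FluidPDE

/-- (α) **LOCAL one-sided contact-intensity ceiling** (repaired stmt-9218): the expected collision sum of any continuous mark
`φ(vᵢ⁻, vⱼ⁻)` over `(s,t]` is at most `C σ²(N+1)^{1/3}/(N+1) ∫_s^t E[Σᵢⱼ φ(vᵢ,vⱼ)‖vᵢ−vⱼ‖ b_r(xᵢ,xⱼ)] dτ` — ONE copy of the evolved law, partners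
within the mesoscopic distance `r` (normalised cone mollifier), `C` uniform in `φ`, `r < r₀` then `N ≥ N₀(r)`.  Rung ½: ratio `→ πg/C`. -/
def ContactIntensityDominationLocal : Prop :=
  ∀ (a₀ θ₀ : T3 → ℝ) (u₀ : T3 → V3), Continuous a₀ → Continuous θ₀ → Continuous u₀ → (∀ x, 0 < a₀ x) → (∀ x, 0 < θ₀ x) → ∃ σ₀ : ℝ, 0 < σ₀ ∧ ∀ σ : ℝ, 0 < σ → σ < σ₀ → ∀ T : ℝ, 0 < T → ∀ Φ : ((N : ℕ) → HardSphereFlow (Torus.geometry (Fin 3)) (hsDiameter σ N) (N + 1)), ∃ C : ENNReal, C < ⊤ ∧ ∃ r₀ : ℝ, 0 < r₀ ∧ ∀ r : ℝ, 0 < r → r < r₀ → ∃ N₀ : ℕ, ∀ N : ℕ, N₀ ≤ N → ∀ s t : ℝ, 0 ≤ s → s ≤ t → t ≤ T → ∀ φ : V3 × V3 → ENNReal, Continuous φ → (∫⁻ z, (∑ᶠ τ ∈ collisionTimes (Torus.geometry (Fin 3)) (hsDiameter σ N) (fun r => (Φ N).flow r z) ∩ Set.Ioc s t, ∑ i : Fin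 (N + 1), ∑ j : Fin (N + 1), if i = j then (0 : ENNReal) else (contactSet (Torus.geometry (Fin 3)) (N + 1) (hsDiameter σ N) i j).indicator (fun y => φ ((((collidePair (Torus.geometry (Fin 3)) i j y)) i).2, (((collidePair (Torus.geometry (Fin 3)) i j y)) j).2)) ((Φ N).flow τ z)) ∂(localGibbsLaw σ a₀ u₀ θ₀ N (Φ N))) ≤ C * ENNReal.ofReal ((σ ^ 2 * ((N + 1 : ℕ) : ℝ) ^ ((1 : ℝ) / 3)) / ((N + 1 : ℕ) : ℝ)) * ∫⁻ τ in Set.Ioc s t, (∫⁻ z, (∑ i : Fin (N + 1), ∑ j : Fin (N + 1), φ ((((Φ N).flow τ z) i).2, (((Φ N).flow τ z) j).2) * ENNReal.ofReal (‖(((Φ N).flow τ z) i).2 - (((Φ N).flow τ z) j).2‖ * coneKernel r (((Φ N).flow τ z) i).1 (((Φ N).flow τ z) j).1)) ∂(localGibbsLaw σ a₀ u₀ θ₀ N (Φ N)))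

/-- (γ) **ONE-RARE-PARTICIPANT contact-intensity ceiling** (the two-copy form of stmt-9218 restricted to the marks
`φ(v,w) = ψ(v)(1+‖w‖)^k`, `k ≤ 3`, uniform in the continuous `ψ`): the partner of the marked particle enters only through bulk moments. -/
def ContactIntensityDominationOneRare : Prop :=
  ∀ (a₀ θ₀ : T3 → ℝ) (u₀ : T3 → V3), Continuous a₀ → Continuous θ₀ → Continuous u₀ → (∀ x, 0 < a₀ x) → (∀ x, 0 < θ₀ x) → ∃ σ₀ : ℝ, 0 < σ₀ ∧ ∀ σ : ℝ, 0 < σ → σ < σ₀ → ∀ T : ℝ, 0 < T → ∀ Φ : ((N : ℕ) → HardSphereFlow (Torus.geometry (Fin 3)) (hsDiameter σ N) (N + 1)), ∃ C : ENNReal, C < ⊤ ∧ ∃ N₀ : ℕ, ∀ N : ℕ, N₀ ≤ N → ∀ s t : ℝ, 0 ≤ s → s ≤ t → t ≤ T → ∀ k : ℕ, k ≤ 3 → ∀ ψ : V3 → ENNReal, Continuous ψ → (∫⁻ z, (∑ᶠ τ ∈ collisionTimes (Torus.geometry (Fin 3)) (hsDiameter σ N) (fun r => (Φ N).flow r z)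 ∩ Set.Ioc s t, ∑ i : Fin (N + 1), ∑ j : Fin (N + 1), if i = j then (0 : ENNReal) else (contactSet (Torus.geometry (Fin 3)) (N + 1) (hsDiameter σ N) i j).indicator (fun y => (fun p : V3 × V3 => ψ p.1 * ENNReal.ofReal ((1 + ‖p.2‖) ^ k)) ((((collidePair (Torus.geometry (Fin 3)) i j y)) i).2, (((collidePair (Torus.geometry (Fin 3)) i j y)) j).2)) ((Φ N).flow τ z)) ∂(localGibbsLaw σ a₀ u₀ θ₀ N (Φ N))) ≤ C * ENNReal.ofReal ((σ ^ 2 * ((N + 1 : ℕ) : ℝ) ^ ((1 : ℝ) / 3)) / ((N + 1 : ℕ) : ℝ)) * ∫⁻ τ in Set.Ioc s t, (∫⁻ z, ∫⁻ z', (∑ i : Fin (N + 1), ∑ j : Fin (N + 1), ψ ((((Φ N).flow τ z) i).2) * ENNReal.ofReal ((1 + ‖(((Φ N).flow τ z') j).2‖) ^ k) * ENNReal.ofReal ‖(((Φ N).flow τ z) i).2 - (((Φ N).flow τ z') j).2‖) ∂(localGibbsLaw σ a₀ u₀ θ₀ N (Φ N)) ∂(localGibbsLaw σ a₀ u₀ θ₀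 N (Φ N)))

end Summit.AtomisticToContinuum.HydrodynamicLimit.Cruxes.EnergyCurrentTails.LocalCeiling

end
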